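import Summits.KontsevichZagierPeriods.KontsevichZagierPeriods.Theorems.RootDecompWalshStrataConicCells

/-!
# Conic descent 5/7: square-root descent — reductions and the charts (a), (b), (c1)

`qD e f g x = e x² + f x + g`; `sqrtDescent_of_pos` (reduce to domains inside `{D > 0}`, the rest is
null or empty), `sqrtDescent_of_nonpos`; chart (a) `e = f = 0`: `x = t/√g` pulls `γ√g` back to the
RATIONAL constant `γ` (`sqrtDescent_const` — the absorption trick: a `ℚ`-semialgebraic linear chart
with algebraic-irrational Jacobian); chart (b) `e = 0 ≠ f`: `x = (t² − g)/f` ↦ `(2γ/|f|)·t²`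
(`sqrtDescent_linear`); chart (c1) `e < 0 < h = g − f²/(4e)` (ellipse arc): vertex form
`qD_eq_vertex`, `x = x₀ + ρ₀(1 − m v²)/(1 + m v²)`, `m = −e`, `ρ₀ = √(h/m)` ↦ `8γmh·v²/(1 + m v²)³`
(`sqrtDescent_ellipse`).  Every chart is rule (2) as typed (`IsSemialgebraicMapOn ℚ`).
Imports: part 4; 0 sorry. [KontsevichZagier2001 §1.2; BCR1998 §2.2]
-/

noncomputable section

open Literature.NumberTheory.Transcendental
open MeasureTheory Set
open MvPolynomial (aeval X C)
open Literature.ModelTheory.ExponentialFields (IsSemialgebraic isSemialgebraic_univ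
  isSemialgebraic_setOf_eval_pos isSemialgebraic_setOf_eval_lt isSemialgebraic_setOf_eval_le
  isSemialgebraic_setOf_eval_nonneg isSemialgebraic_setOf_eval_eq_zero continuous_aeval_real
  tarski_seidenberg_real_holds)
open Summit.KontsevichZagierPeriods.RootDecompWalshStrata.WalshSpanProof (isSemialgebraic_cubeSet
  isBounded_cubeSet)
open Summit.KontsevichZagierPeriods.RootDecompWalshStrata.ConeSpecimen (unitIoo isSemialgebraic_unitIoo
  unitIoo_subset_Icc mem_unitIoo)

namespace Summit.KontsevichZagierPeriods.RootDecompWalshStrata.ConicDescent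

/-! #### 11. Square-root descent: reductions -/

/-- The derivative of `s ↦ s²` at `t` is `2t` (file-local copy). [folklore] -/
private theorem hasDerivAt_sq (t : ℝ) : HasDerivAt (fun s : ℝ => s ^ 2) (2 * t) t := by
  simpa using hasDerivAt_pow 2 t

/-- The quadratic under the root, `D(x) = e x² + f x + g`. -/
def qD (e f g : ℚ) (x : ℝ) : ℝ := (e : ℝ) * x ^ 2 + f * x + g

/-- `x ↦ e x² + f x + g` is `ℚ`-semialgebraic on a `ℚ`-semialgebraic set. [BCR1998 §2.2] -/
theorem isSemialgebraicFunOn_qD (e f g : ℚ) {X : Set (Fin 1 → ℝ)} (hX : IsSemialgebraic ℚ X) :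
    IsSemialgebraicFunOn ℚ X fun v => qD e f g (v 0) :=
  (isSemialgebraicFunOn_aeval hX
    (MvPolynomial.C e * MvPolynomial.X 0 ^ 2 + MvPolynomial.C f * MvPolynomial.X 0 +
      MvPolynomial.C g)).congr fun v _ => by
    simp [qD]

/-- To prove `SqrtDescent` one may assume the domain lies in `{D > 0}`: outside it the integrand
`γ√D` vanishes (rule (1a) + null integrand). [this node] -/
theorem sqrtDescent_of_pos (e f g γ : ℚ)
    (h : ∀ r : KZ.IntegralRep 1, (∀ v ∈ r.domain, 0 < qD e f g (v 0)) →
      EqOn r.integrand (fun v => (γ : ℝ) * √(qD e f g (v 0))) r.domain → InBaker (KZ.of r)) :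
    SqrtDescent e f g γ := by
  intro r hr
  have hA : IsSemialgebraic ℚ {v | v ∈ r.domain ∧ 0 < qD e f g (v 0)} :=
    IsSemialgebraicFunOn.isSemialgebraic_sep_pos
      (isSemialgebraicFunOn_qD e f g r.isSemialgebraic_domain)
  refine InBaker.of_restrict_of_eqOn_zero r hA (fun v hv => hv.1) (fun v hv hvA => ?_) ?_
  · have hD : qD e f g (v 0) ≤ 0 := not_lt.1 fun h' => hvA ⟨hv, h'⟩
    rw [hr hv]
    change (γ : ℝ) * √(qD e f g (v 0)) = 0
    rw [Real.sqrt_eq_zero'.2 hD, mul_zero]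
  · exact h _ (fun v hv => hv.2) fun v hv => hr hv.1

/-- If `D ≤ 0` on the whole line, `SqrtDescent` is trivial. -/
theorem sqrtDescent_of_nonpos (e f g γ : ℚ) (h : ∀ x : ℝ, qD e f g x ≤ 0) : SqrtDescent e f g γ :=
  sqrtDescent_of_pos e f g γ fun r hpos _ => by
    rcases r.domain.eq_empty_or_nonempty with hemp | ⟨v₀, hv₀⟩
    · exact InBaker.of_mem_relations
        (KZ.of_mem_relations_of_volume_eq_zero r (by rw [hemp, measure_empty]))
    · exact absurd (hpos v₀ hv₀) (not_lt.2 (h _))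

/-- The half-line `{t > 0}` is `ℚ`-semialgebraic (private per-file copy; a verbatim twin is landed elsewhere in the tree). [BCR1998 §2.2] -/
private theorem isSemialgebraic_T_pos : IsSemialgebraic ℚ {v : Fin 1 → ℝ | 0 < v 0} := by
  convert isSemialgebraic_setOf_eval_pos (k := ℚ) (R := ℝ)
    (MvPolynomial.X (0 : Fin 1) : MvPolynomial (Fin 1) ℚ) using 1
  ext v
  simp

/-! #### 12. Chart (a): `e = f = 0` — rescaling by `√g` -/

/-- `γ√g` on any domain: `x = t/√g` pulls it back to the constant `γ`. [this node] -/
theorem sqrtDescent_const (g γ : ℚ) : SqrtDescent 0 0 g γ := by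
  refine sqrtDescent_of_pos 0 0 g γ fun r hpos hr => ?_
  rcases r.domain.eq_empty_or_nonempty with hemp | ⟨v₀, hv₀⟩
  · exact InBaker.of_mem_relations
      (KZ.of_mem_relations_of_volume_eq_zero r (by rw [hemp, measure_empty]))
  have hg : (0 : ℝ) < g := by have := hpos v₀ hv₀; simpa [qD] using this
  have hsg : 0 < √(g : ℝ) := Real.sqrt_pos.2 hg
  set c : ℝ := (√(g : ℝ))⁻¹ with hc
  have hc0 : 0 < c := inv_pos.2 hsg
  refine InBaker.of_cov₁ r isSemialgebraic_univ (fun t => c * t) (fun _ => c) ?_ ?_ ?_ ?_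
    (MvPolynomial.C γ) 1 (fun v _ => by simp) fun v _ hv => ?_
  · have h : IsSemialgebraicFunOn ℚ (univ : Set (Fin 1 → ℝ)) fun v => √(((g⁻¹ : ℚ) : ℝ)) * v 0 :=
      IsSemialgebraicFunOn.mul_holds
        (IsSemialgebraicFunOn.sqrt_holds (isSemialgebraicFunOn_ratCast isSemialgebraic_univ _))
        (isSemialgebraicFunOn_apply isSemialgebraic_univ 0)
    refine h.congr fun v _ => ?_
    rw [hc, Rat.cast_inv, Real.sqrt_inv]
  · intro v _
    simpa using (hasDerivAt_id (v 0)).const_mul c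
  · intro s _ t _ h
    exact mul_left_cancel₀ hc0.ne' h
  · intro x _
    exact ⟨fun _ => √(g : ℝ) * x 0, mem_univ _, by simp only; rw [hc]; field_simp⟩
  · rw [hr hv]
    simp only [lift₁, qD, map_one, MvPolynomial.aeval_C, eq_ratCast, div_one, Rat.cast_zero,
      zero_mul, zero_add, abs_of_pos hc0]
    rw [hc, mul_assoc, mul_inv_cancel₀ hsg.ne', mul_one]

/-! #### 13. Chart (b): `e = 0`, `f ≠ 0` — `x = (t² − g)/f` -/

/-- `γ√(fx + g)`: the substitution `x = (t² − g)/f`, `t > 0` pulls it back to `(2γ/|f|)·t²`.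
[this node] -/
theorem sqrtDescent_linear (f g γ : ℚ) (hf : f ≠ 0) : SqrtDescent 0 f g γ := by
  refine sqrtDescent_of_pos 0 f g γ fun r hpos hr => ?_
  have hf0 : (f : ℝ) ≠ 0 := by exact_mod_cast hf
  refine InBaker.of_cov₁ r isSemialgebraic_T_pos (fun t => (t ^ 2 - g) / f) (fun t => 2 * t / f)
    ?_ ?_ ?_ ?_ (MvPolynomial.C (2 * γ / |f|) * MvPolynomial.X 0 ^ 2) 1 (fun v _ => by simp)
    fun v hv hvd => ?_
  · exact (isSemialgebraicFunOn_aeval isSemialgebraic_T_pos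
      ((MvPolynomial.X 0 ^ 2 - MvPolynomial.C g) * MvPolynomial.C f⁻¹)).congr fun v _ => by
      simp [div_eq_mul_inv]
  · intro v _
    exact (((hasDerivAt_sq (v 0)).sub_const (g : ℝ)).div_const (f : ℝ))
  · intro s hs t ht h
    have hs0 : 0 < s 0 := hs
    have ht0 : 0 < t 0 := ht
    have h2 : s 0 ^ 2 = t 0 ^ 2 := by
      have := (div_left_inj' hf0).1 h
      linarith
    exact (pow_left_inj₀ hs0.le ht0.le two_ne_zero).1 h2
  · intro x hx
    have hD : 0 < (f : ℝ) * x 0 + g := by have := hpos x hx; simpa [qD] using this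
    refine ⟨fun _ => √((f : ℝ) * x 0 + g), Real.sqrt_pos.2 hD, ?_⟩
    simp only
    rw [Real.sq_sqrt hD.le]
    field_simp
    ring
  · have hv0 : 0 < v 0 := hv
    have hin : (f : ℝ) * ((v 0 ^ 2 - g) / f) + g = v 0 ^ 2 := by field_simp; ring
    rw [hr hvd]
    simp only [lift₁, qD, map_mul, map_pow, MvPolynomial.aeval_C, MvPolynomial.aeval_X, map_one,
      div_one, eq_ratCast, Rat.cast_zero, zero_mul, zero_add]
    rw [hin, Real.sqrt_sq hv0.le, abs_div, abs_of_pos (by positivity : (0 : ℝ) < 2 * v 0)]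
    push_cast
    field_simp

/-! #### 14. Chart (c1): `e < 0`, `h > 0` — rational parametrisation of the ellipse branch -/

/-- Vertex form of the quadratic `qD e f g`: `e·x² + f·x + g = e·(x − x₀)² + h` with `x₀ = −f/(2e)` and
`h = g − f²/(4e)` (`e ≠ 0`). [folklore] -/
theorem qD_eq_vertex (e f g : ℚ) (he : e ≠ 0) (x : ℝ) :
    qD e f g x = (e : ℝ) * (x - ((-f / (2 * e) : ℚ) : ℝ)) ^ 2 + ((g - f ^ 2 / (4 * e) : ℚ) : ℝ) := by
  have he0 : (e : ℝ) ≠ 0 := by exact_mod_cast he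
  simp only [qD]
  push_cast
  field_simp
  ring

/-- `γ√(e x² + f x + g)` with `e < 0 < h = g − f²/(4e)`: writing `D = h − m(x − x₀)²` (`m = −e`),
the substitution `x = x₀ + ρ₀(1 − m v²)/(1 + m v²)`, `ρ₀ = √(h/m)`, `v > 0`, pulls the integrand
back to the rational function `8γmh·v²/(1 + m v²)³`. [this node; the Euler–Weierstrass chart of
`Theorems/RootDecompWalshStrataConeBaker`] -/
theorem sqrtDescent_ellipse (e f g γ : ℚ) (he : e < 0) (hh : 0 < g - f ^ 2 / (4 * e)) :
    SqrtDescent e f g γ := by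
  refine sqrtDescent_of_pos e f g γ fun r hpos hr => ?_
  have he0 : (e : ℝ) ≠ 0 := by exact_mod_cast he.ne
  have hm0 : (0 : ℝ) < ((-e : ℚ) : ℝ) := by push_cast; exact_mod_cast neg_pos.2 he
  have hh0 : (0 : ℝ) < ((g - f ^ 2 / (4 * e) : ℚ) : ℝ) := by exact_mod_cast hh
  -- real abbreviations
  set M : ℝ := ((-e : ℚ) : ℝ) with hMdef
  set H : ℝ := ((g - f ^ 2 / (4 * e) : ℚ) : ℝ) with hHdef
  set X₀ : ℝ := ((-f / (2 * e) : ℚ) : ℝ) with hX₀def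
  have hMe : M = -e := by rw [hMdef]; push_cast; ring
  have hHe : H = g - f ^ 2 / (4 * e) := by rw [hHdef]; push_cast; ring
  have hX₀e : X₀ = -f / (2 * e) := by rw [hX₀def]; push_cast; ring
  set ρ₀ : ℝ := √(H / M) with hρ₀def
  have hρ₀ : 0 < ρ₀ := Real.sqrt_pos.2 (div_pos hh0 hm0)
  have hρ₀sq : ρ₀ ^ 2 = H / M := Real.sq_sqrt (div_pos hh0 hm0).le
  have hHρ : H = M * ρ₀ ^ 2 := by rw [hρ₀sq]; field_simp
  have hG : (g : ℝ) = M * ρ₀ ^ 2 + f ^ 2 / (4 * e) := by rw [← hHρ, hHe]; ring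
  have hden : ∀ s : ℝ, 0 < 1 + M * s ^ 2 := fun s =>
    add_pos_of_pos_of_nonneg one_pos (mul_nonneg hm0.le (sq_nonneg s))
  -- the chart
  set W : ℝ → ℝ := fun s => (1 - M * s ^ 2) / (1 + M * s ^ 2) with hWdef
  set gφ : ℝ → ℝ := fun s => X₀ + ρ₀ * W s with hgdef
  set g' : ℝ → ℝ := fun s => ρ₀ * (-4 * M * s) / (1 + M * s ^ 2) ^ 2 with hg'def
  have haq : ∀ v : Fin 1 → ℝ, aeval v ((1 + MvPolynomial.C (-e) * MvPolynomial.X 0 ^ 2) ^ 3 :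
      MvPolynomial (Fin 1) ℚ) = (1 + M * v 0 ^ 2) ^ 3 := fun v => by
    simp only [map_pow, map_add, map_one, map_mul, MvPolynomial.aeval_C, MvPolynomial.aeval_X,
      eq_ratCast, hMdef]
  refine InBaker.of_cov₁ r isSemialgebraic_T_pos gφ g' ?_ ?_ ?_ ?_
    (MvPolynomial.C (8 * γ * (-e) * (g - f ^ 2 / (4 * e))) * MvPolynomial.X 0 ^ 2)
    ((1 + MvPolynomial.C (-e) * MvPolynomial.X 0 ^ 2) ^ 3)
    (fun v _ => by rw [haq]; exact pow_ne_zero 3 (hden (v 0)).ne') fun v hv hvd => ?_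
  · -- semialgebraic
    have hW : IsSemialgebraicFunOn ℚ {v : Fin 1 → ℝ | 0 < v 0} fun v => W (v 0) :=
      (isSemialgebraicFunOn_aeval_div_aeval isSemialgebraic_T_pos
        (1 - MvPolynomial.C (-e) * MvPolynomial.X 0 ^ 2)
        (1 + MvPolynomial.C (-e) * MvPolynomial.X 0 ^ 2)
        fun v _ => by
          simp only [map_add, map_one, map_mul, map_pow, MvPolynomial.aeval_C,
            MvPolynomial.aeval_X, eq_ratCast]
          exact (hden (v 0)).ne').congr fun v _ => by
        simp only [hWdef, map_sub, map_add, map_one, map_mul, map_pow, MvPolynomial.aeval_C,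
          MvPolynomial.aeval_X, eq_ratCast, hMdef]
    have hρ : IsSemialgebraicFunOn ℚ {v : Fin 1 → ℝ | 0 < v 0} fun _ => ρ₀ :=
      (IsSemialgebraicFunOn.sqrt_holds (isSemialgebraicFunOn_ratCast isSemialgebraic_T_pos
        ((g - f ^ 2 / (4 * e)) / (-e)))).congr fun v _ => by
          rw [hρ₀def, hHdef, hMdef]; push_cast; ring_nf
    exact ((isSemialgebraicFunOn_ratCast isSemialgebraic_T_pos (-f / (2 * e))).add_holds
      (hρ.mul_holds hW)).congr fun v _ => by
        simp only [hgdef, hX₀def, Pi.add_apply, Pi.mul_apply]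
  · -- derivative
    intro v _
    have h1 : HasDerivAt (fun s : ℝ => 1 - M * s ^ 2) (-(M * (2 * v 0))) (v 0) :=
      ((hasDerivAt_sq (v 0)).const_mul M).const_sub 1
    have h2 : HasDerivAt (fun s : ℝ => 1 + M * s ^ 2) (M * (2 * v 0)) (v 0) :=
      ((hasDerivAt_sq (v 0)).const_mul M).const_add 1
    have h3 := ((h1.div h2 (hden (v 0)).ne').const_mul ρ₀).const_add X₀
    refine h3.congr_deriv ?_
    simp only [hg'def]
    field_simp
    ring
  · -- injective on `v > 0`
    intro s hs t ht hst
    have hs0 : 0 < s 0 := hs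
    have ht0 : 0 < t 0 := ht
    have h1 : W (s 0) = W (t 0) := by
      have h' : X₀ + ρ₀ * W (s 0) = X₀ + ρ₀ * W (t 0) := hst
      exact mul_left_cancel₀ hρ₀.ne' (add_left_cancel h')
    have h1' : (1 - M * s 0 ^ 2) / (1 + M * s 0 ^ 2) = (1 - M * t 0 ^ 2) / (1 + M * t 0 ^ 2) := h1
    rw [div_eq_div_iff (hden _).ne' (hden _).ne'] at h1'
    have h2 : s 0 ^ 2 = t 0 ^ 2 := by
      have h3 : M * s 0 ^ 2 = M * t 0 ^ 2 := by linarith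
      exact mul_left_cancel₀ hm0.ne' h3
    exact (pow_left_inj₀ hs0.le ht0.le two_ne_zero).1 h2
  · -- surjective onto the domain (`⊆ {D > 0} = {|x − x₀| < ρ₀}`)
    intro x hx
    set u : ℝ := x 0 - X₀ with hudef
    have hD := hpos x hx
    rw [qD_eq_vertex e f g he.ne] at hD
    have hD' : 0 < (e : ℝ) * u ^ 2 + H := hD
    have hu2 : u ^ 2 < ρ₀ ^ 2 := by
      rw [hρ₀sq, lt_div_iff₀ hm0, hMe]
      linarith
    obtain ⟨hul, hur⟩ := abs_lt_of_sq_lt_sq' hu2 hρ₀.le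
    have hpu : 0 < ρ₀ + u := by linarith
    have hmu : 0 < ρ₀ - u := by linarith
    set w : ℝ := √((ρ₀ - u) / (M * (ρ₀ + u))) with hwdef
    have hwpos : 0 < w := Real.sqrt_pos.2 (div_pos hmu (mul_pos hm0 hpu))
    have hw2 : M * w ^ 2 = (ρ₀ - u) / (ρ₀ + u) := by
      rw [hwdef, Real.sq_sqrt (div_pos hmu (mul_pos hm0 hpu)).le]
      field_simp
    refine ⟨fun _ => w, hwpos, ?_⟩
    change X₀ + ρ₀ * ((1 - M * w ^ 2) / (1 + M * w ^ 2)) = x 0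
    rw [hw2]
    have e1 : (1 : ℝ) - (ρ₀ - u) / (ρ₀ + u) = 2 * u / (ρ₀ + u) := by field_simp; ring
    have e2 : (1 : ℝ) + (ρ₀ - u) / (ρ₀ + u) = 2 * ρ₀ / (ρ₀ + u) := by field_simp; ring
    rw [e1, e2]
    have : (2 * u / (ρ₀ + u)) / (2 * ρ₀ / (ρ₀ + u)) = u / ρ₀ := by
      field_simp
    rw [this, mul_div_cancel₀ u hρ₀.ne', hudef]
    ring
  · -- the pulled-back integrand
    have hv0 : 0 < v 0 := hv
    have hnum : 0 < 2 * ρ₀ * M * v 0 := by positivity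
    have hWv : (e : ℝ) * (gφ (v 0)) ^ 2 + f * gφ (v 0) + g =
        (2 * ρ₀ * M * v 0 / (1 + M * v 0 ^ 2)) ^ 2 := by
      have hd := (hden (v 0)).ne'
      have heM : (e : ℝ) = -M := by rw [hMe]; ring
      have hM0 : M ≠ 0 := hm0.ne'
      simp only [hgdef, hWdef]
      rw [hG, hX₀e, heM]
      field_simp
      ring
    have hsq : √((e : ℝ) * (gφ (v 0)) ^ 2 + f * gφ (v 0) + g) =
        2 * ρ₀ * M * v 0 / (1 + M * v 0 ^ 2) := by
      rw [hWv, Real.sqrt_sq (div_pos hnum (hden _)).le]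
    have habs : |g' (v 0)| = ρ₀ * (4 * M * v 0) / (1 + M * v 0 ^ 2) ^ 2 := by
      simp only [hg'def]
      rw [show ρ₀ * (-4 * M * v 0) / (1 + M * v 0 ^ 2) ^ 2 =
          -(ρ₀ * (4 * M * v 0) / (1 + M * v 0 ^ 2) ^ 2) by ring, abs_neg, abs_of_pos]
      exact div_pos (by positivity) (pow_pos (hden _) 2)
    rw [hr hvd]
    have hlift : lift₁ gφ v 0 = gφ (v 0) := rfl
    simp only [qD, hlift, map_mul, map_pow, MvPolynomial.aeval_C, MvPolynomial.aeval_X, eq_ratCast,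
      haq]
    rw [hsq, habs]
    have hd := (hden (v 0)).ne'
    push_cast
    rw [← hMe, ← hHe, hHρ]
    field_simp
    ring

end Summit.KontsevichZagierPeriods.RootDecompWalshStrata.ConicDescent

end
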